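import Mathlib
import Summits.Ventures.PercRepro2.UniversalBundleStepSP
import Summits.Ventures.PercRepro2.UniversalB33

/-! # Towers `X ∧ B_K`, `K ≥ 3`, over small networks `X` with a computed package
(seat mine-b, cell pub-perc-repro2; MINE-B.md §25.2, §25.12)

For a fixed series–parallel network `X` of free edges, the package `(f, θ, g)` of
`SP.universal_ser_bundle` — an (UH*) assignment, a red-up map on `{r ≥ 1, b ≥ 2}` and the level-1
datum (L1) on the blue-1 targets of the blue-1 sources — is a finite object, found by matching and
verified here by `decide +kernel` (tables; no `native_decide`).  `SP.universal_ser_bundle` then gives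
(UH*) on `X ∧ B_K` for EVERY `K ≥ 3` at once: infinite families of networks of flow `≥ 3` that are not
series of bundles, beyond the `≤ 8`-edge kernel census of UniversalSmall8*.lean.  Networks:
* (((e ∗ e) ∗ e) ∧ (((e ∧ e) ∗ (e ∧ e)) ∗ e)): 8 edges, 256 configurations, 77 sources / 101 slots, |Q| = 9, |D¹| = 0
The configuration order of an SP term is decidable by `SP.confDecLE` (UniversalB33.lean). -/

namespace Summit.Ventures.PercRepro2.V2Closure

open Summit.Ventures.PercRepro2.UHClosure

/-- the injectivity hypothesis of the (L1) datum, through a list containing its domain: the kernel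
then evaluates `InD1` once per configuration instead of once per pair -/
theorem inD1_inj_of_list {X : Type*} [Preorder X] [Fintype X] {r b : X → ℕ}
    {f : SlotL (USrc r b) b → X} {g : X → X} (L : List X)
    (hL : ∀ x, InD1 r b f x → x ∈ L) (hinj : ∀ x ∈ L, ∀ x' ∈ L, g x = g x' → x = x') :
    ∀ x x', InD1 r b f x → InD1 r b f x' → g x = g x' → x = x' :=
  fun x x' hx hx' h => hinj x (hL x hx) x' (hL x' hx') h

/-- the network `B₃ ∧ (P₂ ∗ P₂ ∗ e)` (8 edges, flow 3) -/
abbrev SP.b3p2p2e : SP := (SP.ser (SP.par (SP.par SP.free SP.free) SP.free) (SP.par (SP.par (SP.ser SP.free SP.free) (SP.ser SP.free SP.free)) SP.free))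

/-- the (UH*) table of `b3p2p2e`: (source, slot, target) -/
def b3p2p2eFT : List (SP.b3p2p2e.Conf × ℕ × SP.b3p2p2e.Conf) := [
  ((((true, true), true), (((true, true), (false, false)), false)), 0, (((false, true), true), (((true, false), (false, false)), false))),
  ((((true, true), true), (((true, true), (true, false)), false)), 0, (((true, true), false), (((true, false), (true, false)), false))),
  ((((true, true), true), (((true, true), (false, true)), false)), 0, (((false, true), true), (((false, false), (false, false)), false))),
  ((((true, true), true), (((false, false), (true, true)), false)), 0, (((true, true), false), (((false, false), (true, false)), false))),
  ((((true, true), true), (((true, false), (true, true)), false)), 0, (((true, false), true), (((true, false), (false, true)), false))),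
  ((((true, true), true), (((false, true), (true, true)), false)), 0, (((false, true), true), (((false, true), (true, false)), false))),
  ((((true, true), true), (((true, true), (true, true)), false)), 0, (((true, true), false), (((true, true), (false, false)), false))),
  ((((true, true), true), (((true, true), (true, true)), false)), 1, (((true, false), true), (((true, true), (false, false)), false))),
  ((((true, true), true), (((false, false), (false, false)), true)), 0, (((true, false), true), (((false, false), (false, false)), false))),
  ((((true, true), true), (((true, false), (false, false)), true)), 0, (((true, false), true), (((true, false), (false, false)), false))),
  ((((true, true), true), (((false, true), (false, false)), true)), 0, (((true, false), true), (((false, true), (false, false)), false))),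
  ((((true, true), true), (((true, true), (false, false)), true)), 0, (((true, true), false), (((false, false), (false, false)), true))),
  ((((true, true), true), (((true, true), (false, false)), true)), 1, (((true, false), true), (((false, false), (false, false)), true))),
  ((((true, true), true), (((false, false), (true, false)), true)), 0, (((true, false), true), (((false, false), (true, false)), false))),
  ((((true, false), false), (((true, false), (true, false)), true)), 0, (((true, false), false), (((true, false), (true, false)), false))),
  ((((false, true), false), (((true, false), (true, false)), true)), 0, (((false, true), false), (((true, false), (true, false)), false))),
  ((((true, true), false), (((true, false), (true, false)), true)), 0, (((true, true), false), (((true, false), (false, false)), false))),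
  ((((false, false), true), (((true, false), (true, false)), true)), 0, (((false, false), true), (((true, false), (true, false)), false))),
  ((((true, false), true), (((true, false), (true, false)), true)), 0, (((true, false), true), (((true, false), (true, false)), false))),
  ((((false, true), true), (((true, false), (true, false)), true)), 0, (((false, true), true), (((true, false), (true, false)), false))),
  ((((true, true), true), (((true, false), (true, false)), true)), 0, (((false, true), true), (((false, false), (true, false)), false))),
  ((((true, false), false), (((false, true), (true, false)), true)), 0, (((true, false), false), (((false, true), (true, false)), false))),
  ((((false, true), false), (((false, true), (true, false)), true)), 0, (((false, true), false), (((false, true), (true, false)), false))),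
  ((((true, true), false), (((false, true), (true, false)), true)), 0, (((true, true), false), (((false, true), (false, false)), false))),
  ((((false, false), true), (((false, true), (true, false)), true)), 0, (((false, false), true), (((false, true), (true, false)), false))),
  ((((true, false), true), (((false, true), (true, false)), true)), 0, (((true, false), true), (((false, true), (true, false)), false))),
  ((((false, true), true), (((false, true), (true, false)), true)), 0, (((false, true), true), (((false, true), (false, false)), false))),
  ((((true, true), true), (((false, true), (true, false)), true)), 0, (((true, true), false), (((false, true), (true, false)), false))),
  ((((true, false), false), (((true, true), (true, false)), true)), 0, (((false, false), false), (((true, true), (true, false)), false))),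
  ((((false, true), false), (((true, true), (true, false)), true)), 0, (((false, false), false), (((true, false), (false, false)), true))),
  ((((true, true), false), (((true, true), (true, false)), true)), 0, (((false, true), false), (((true, true), (true, false)), false))),
  ((((true, true), false), (((true, true), (true, false)), true)), 1, (((true, false), false), (((true, true), (true, false)), false))),
  ((((false, false), true), (((true, true), (true, false)), true)), 0, (((false, false), false), (((false, true), (false, false)), true))),
  ((((true, false), true), (((true, true), (true, false)), true)), 0, (((false, false), true), (((true, true), (true, false)), false))),
  ((((true, false), true), (((true, true), (true, false)), true)), 1, (((false, false), true), (((true, false), (false, false)), true))),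
  ((((false, true), true), (((true, true), (true, false)), true)), 0, (((false, true), true), (((false, false), (false, false)), true))),
  ((((false, true), true), (((true, true), (true, false)), true)), 1, (((false, true), true), (((true, true), (false, false)), false))),
  ((((true, true), true), (((true, true), (true, false)), true)), 0, (((true, true), false), (((true, true), (true, false)), false))),
  ((((true, true), true), (((true, true), (true, false)), true)), 1, (((true, false), true), (((true, true), (true, false)), false))),
  ((((true, true), true), (((false, false), (false, true)), true)), 0, (((true, true), false), (((false, false), (false, true)), false))),
  ((((true, false), false), (((true, false), (false, true)), true)), 0, (((true, false), false), (((true, false), (false, true)), false))),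
  ((((false, true), false), (((true, false), (false, true)), true)), 0, (((false, true), false), (((true, false), (false, true)), false))),
  ((((true, true), false), (((true, false), (false, true)), true)), 0, (((true, true), false), (((true, false), (false, true)), false))),
  ((((false, false), true), (((true, false), (false, true)), true)), 0, (((false, false), true), (((true, false), (false, true)), false))),
  ((((true, false), true), (((true, false), (false, true)), true)), 0, (((true, false), true), (((false, false), (false, true)), false))),
  ((((false, true), true), (((true, false), (false, true)), true)), 0, (((false, true), true), (((false, false), (false, true)), false))),
  ((((true, true), true), (((true, false), (false, true)), true)), 0, (((false, true), true), (((true, false), (false, true)), false))),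
  ((((true, false), false), (((false, true), (false, true)), true)), 0, (((true, false), false), (((false, true), (false, true)), false))),
  ((((false, true), false), (((false, true), (false, true)), true)), 0, (((false, true), false), (((false, true), (false, true)), false))),
  ((((true, true), false), (((false, true), (false, true)), true)), 0, (((true, true), false), (((false, false), (false, false)), false))),
  ((((false, false), true), (((false, true), (false, true)), true)), 0, (((false, false), true), (((false, true), (false, true)), false))),
  ((((true, false), true), (((false, true), (false, true)), true)), 0, (((true, false), true), (((false, true), (false, true)), false))),
  ((((false, true), true), (((false, true), (false, true)), true)), 0, (((false, true), true), (((false, true), (false, true)), false))),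
  ((((true, true), true), (((false, true), (false, true)), true)), 0, (((true, true), false), (((false, true), (false, true)), false))),
  ((((true, false), false), (((true, true), (false, true)), true)), 0, (((false, false), false), (((true, true), (false, true)), false))),
  ((((false, true), false), (((true, true), (false, true)), true)), 0, (((false, false), false), (((true, true), (false, false)), true))),
  ((((true, true), false), (((true, true), (false, true)), true)), 0, (((false, true), false), (((true, true), (false, true)), false))),
  ((((true, true), false), (((true, true), (false, true)), true)), 1, (((false, true), false), (((true, false), (false, false)), true))),
  ((((false, false), true), (((true, true), (false, true)), true)), 0, (((false, false), false), (((false, false), (false, true)), true))),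
  ((((true, false), true), (((true, true), (false, true)), true)), 0, (((false, false), true), (((true, true), (false, true)), false))),
  ((((true, false), true), (((true, true), (false, true)), true)), 1, (((false, false), true), (((false, true), (false, false)), true))),
  ((((false, true), true), (((true, true), (false, true)), true)), 0, (((false, true), false), (((false, true), (false, false)), true))),
  ((((false, true), true), (((true, true), (false, true)), true)), 1, (((false, false), true), (((true, true), (false, false)), true))),
  ((((true, true), true), (((true, true), (false, true)), true)), 0, (((true, false), false), (((true, true), (false, true)), false))),
  ((((true, true), true), (((true, true), (false, true)), true)), 1, (((true, true), false), (((true, true), (false, true)), false))),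
  ((((true, true), true), (((false, false), (true, true)), true)), 0, (((true, true), false), (((false, false), (true, true)), false))),
  ((((true, true), true), (((false, false), (true, true)), true)), 1, (((true, false), true), (((false, false), (true, true)), false))),
  ((((true, false), false), (((true, false), (true, true)), true)), 0, (((false, false), false), (((true, false), (true, true)), false))),
  ((((false, true), false), (((true, false), (true, true)), true)), 0, (((false, false), false), (((false, false), (true, false)), true))),
  ((((true, true), false), (((true, false), (true, true)), true)), 0, (((false, true), false), (((true, false), (true, true)), false))),
  ((((true, true), false), (((true, false), (true, true)), true)), 1, (((true, false), false), (((true, false), (true, true)), false))),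
  ((((false, false), true), (((true, false), (true, true)), true)), 0, (((false, false), false), (((false, false), (true, true)), true))),
  ((((true, false), true), (((true, false), (true, true)), true)), 0, (((false, false), true), (((true, false), (true, true)), false))),
  ((((true, false), true), (((true, false), (true, true)), true)), 1, (((false, false), true), (((false, false), (true, false)), true))),
  ((((false, true), true), (((true, false), (true, true)), true)), 0, (((false, false), true), (((false, false), (false, true)), true))),
  ((((false, true), true), (((true, false), (true, true)), true)), 1, (((false, true), true), (((false, false), (true, true)), false))),
  ((((true, true), true), (((true, false), (true, true)), true)), 0, (((true, true), false), (((true, false), (true, true)), false))),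
  ((((true, true), true), (((true, false), (true, true)), true)), 1, (((true, false), true), (((true, false), (true, true)), false))),
  ((((true, false), false), (((false, true), (true, true)), true)), 0, (((false, false), false), (((false, true), (true, true)), false))),
  ((((false, true), false), (((false, true), (true, true)), true)), 0, (((false, false), false), (((false, true), (true, false)), false))),
  ((((true, true), false), (((false, true), (true, true)), true)), 0, (((false, true), false), (((false, true), (true, true)), false))),
  ((((true, true), false), (((false, true), (true, true)), true)), 1, (((false, true), false), (((false, false), (true, false)), true))),
  ((((false, false), true), (((false, true), (true, true)), true)), 0, (((false, false), false), (((false, true), (false, true)), false))),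
  ((((true, false), true), (((false, true), (true, true)), true)), 0, (((false, false), true), (((false, true), (true, true)), false))),
  ((((true, false), true), (((false, true), (true, true)), true)), 1, (((false, false), true), (((false, false), (true, true)), true))),
  ((((false, true), true), (((false, true), (true, true)), true)), 0, (((false, true), false), (((false, false), (false, true)), true))),
  ((((false, true), true), (((false, true), (true, true)), true)), 1, (((false, true), false), (((false, false), (true, true)), true))),
  ((((true, true), true), (((false, true), (true, true)), true)), 0, (((true, false), false), (((false, true), (true, true)), false))),
  ((((true, true), true), (((false, true), (true, true)), true)), 1, (((true, true), false), (((false, true), (true, true)), false))),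
  ((((true, false), false), (((true, true), (true, true)), true)), 0, (((false, false), false), (((true, true), (true, true)), false))),
  ((((false, true), false), (((true, true), (true, true)), true)), 0, (((false, false), false), (((true, false), (true, false)), false))),
  ((((true, true), false), (((true, true), (true, true)), true)), 0, (((false, true), false), (((true, true), (true, true)), false))),
  ((((true, true), false), (((true, true), (true, true)), true)), 1, (((false, true), false), (((true, true), (false, false)), true))),
  ((((false, false), true), (((true, true), (true, true)), true)), 0, (((false, false), false), (((true, false), (false, true)), false))),
  ((((true, false), true), (((true, true), (true, true)), true)), 0, (((false, false), true), (((true, true), (true, true)), false))),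
  ((((true, false), true), (((true, true), (true, true)), true)), 1, (((true, false), true), (((true, true), (false, true)), false))),
  ((((false, true), true), (((true, true), (true, true)), true)), 0, (((false, true), true), (((true, true), (true, false)), false))),
  ((((false, true), true), (((true, true), (true, true)), true)), 1, (((false, true), true), (((true, true), (false, true)), false))),
  ((((true, true), true), (((true, true), (true, true)), true)), 0, (((true, true), false), (((true, true), (true, true)), false))),
  ((((true, true), true), (((true, true), (true, true)), true)), 1, (((true, false), true), (((true, true), (true, true)), false))),
  ((((true, true), true), (((true, true), (true, true)), true)), 2, (((false, true), true), (((true, true), (true, true)), false)))]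

/-- the red-up table of `b3p2p2e`: (x, θ x) on {r ≥ 1, b ≥ 2} -/
def b3p2p2eTT : List (SP.b3p2p2e.Conf × SP.b3p2p2e.Conf) := [
  ((((true, true), false), (((true, true), (true, true)), false)), (((true, false), false), (((true, true), (false, false)), false))),
  ((((true, false), true), (((true, true), (true, true)), false)), (((false, false), true), (((true, true), (false, false)), false))),
  ((((false, true), true), (((true, true), (true, true)), false)), (((false, true), false), (((true, true), (false, false)), false))),
  ((((true, true), false), (((true, true), (false, false)), true)), (((true, false), false), (((false, false), (false, false)), true))),
  ((((true, false), true), (((true, true), (false, false)), true)), (((false, false), true), (((false, false), (false, false)), true))),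
  ((((false, true), true), (((true, true), (false, false)), true)), (((false, true), false), (((false, false), (false, false)), true))),
  ((((true, true), false), (((false, false), (true, true)), true)), (((true, false), false), (((false, false), (true, true)), false))),
  ((((true, false), true), (((false, false), (true, true)), true)), (((false, false), true), (((false, false), (true, true)), false))),
  ((((false, true), true), (((false, false), (true, true)), true)), (((false, true), false), (((false, false), (true, true)), false)))]

/-- the (L1) table of `b3p2p2e`: (x, g x) on the blue-1 targets of the blue-1 sources -/
def b3p2p2eGT : List (SP.b3p2p2e.Conf × SP.b3p2p2e.Conf) := [
]

/-- the (UH*) assignment of `b3p2p2e` (table lookup) -/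
def b3p2p2eAssign (p : SlotL (USrc SP.b3p2p2e.rLab SP.b3p2p2e.bLab) SP.b3p2p2e.bLab) : SP.b3p2p2e.Conf :=
  match b3p2p2eFT.find? (fun e => e.1 = p.1.1.1 ∧ e.2.1 = p.1.2.val) with
  | some e => e.2.2
  | none => p.1.1.1

/-- the red-up map of `b3p2p2e` (table lookup) -/
def b3p2p2eTheta (x : SP.b3p2p2e.Conf) : SP.b3p2p2e.Conf :=
  match b3p2p2eTT.find? (fun e => e.1 = x) with
  | some e => e.2
  | none => x

/-- the (L1) datum of `b3p2p2e` (table lookup) -/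
def b3p2p2eGmap (x : SP.b3p2p2e.Conf) : SP.b3p2p2e.Conf :=
  match b3p2p2eGT.find? (fun e => e.1 = x) with
  | some e => e.2
  | none => x

/-- membership in the (L1) domain of `b3p2p2e` is decidable -/
instance : DecidablePred (InD1 SP.b3p2p2e.rLab SP.b3p2p2e.bLab b3p2p2eAssign) := fun _ => by
  unfold InD1; infer_instance

set_option maxRecDepth 40000 in
/-- **(UH*) on `b3p2p2e ∧ B_K` for every `K ≥ 3`** — the package of `b3p2p2e` by kernel computation, the
series step by `SP.universal_ser_bundle` (the injectivity of the (L1) datum through its table, `inD1_inj_of_list`). -/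
theorem SP.universal_b3p2p2e_bundle (K : ℕ) (hK : 3 ≤ K) :
    Universal (SP.ser SP.b3p2p2e (SP.bundle K)).rLab (SP.ser SP.b3p2p2e (SP.bundle K)).bLab :=
  SP.universal_ser_bundle SP.b3p2p2e K hK b3p2p2eAssign (by decide +kernel) (by decide +kernel)
    b3p2p2eTheta (by decide +kernel) (by decide +kernel) b3p2p2eGmap (by decide +kernel) (by decide +kernel)
    (by decide +kernel) (inD1_inj_of_list (b3p2p2eGT.map Prod.fst) (by decide +kernel) (by decide +kernel))

end Summit.Ventures.PercRepro2.V2Closure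

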